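import Mathlib
import HarnessLib
import HarnessLib.Audit
import Summits.Schanuel.Statement
import HarnessLib.Audit.Status.Attr

/-!
Route: RelationCounting

DORMANT since 2026-08-23T07:27:05Z (reconciler: no traction for 6 d (last activity statement-checked at 2026-08-17T07:25:24Z); parked, not closed — `ledger route dormant route-Schanuel-RelationCounting --off` to reactivate) — unstaffed, not closed; items shared with open routes are served there. `ledger route dormant <id> --off` reactivates.

# Route RelationCounting — relation counting on the exponential leaf — Schanuel as a counting gap
closed by width amplification

It suffices to show X = CountingGapHigher ∧ CountingGapPair: RELATION COUNTING ON THE EXPONENTIAL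
LEAF. Fix a level k ≥ 1 and a strip
height b. Call w ∈ ℂ^M a COUNTED POINT at complexity T if |Re wᵢ| ≤ T, |Im wᵢ| ≤ b, some k+1
coordinates of w are ℚ-linearly
independent, and x = (w, e^w) satisfies s ≥ 2M − k integer polynomial relations of total degree ≤ T
and coefficients ≤ T with
ℂ-linearly independent gradients at x, M of them forming a non-degenerate Khovanskii system
(det((∂_Xⱼ + Yⱼ∂_Yⱼ)Pᵢ)(x) ≠ 0).
Independent gradients force trdeg ℚ(w, e^w) ≤ 2M − s ≤ k < k+1 ≤ rank, so every counted point is a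
Schanuel counterexample and
under Schanuel there are none. X says: for every k and b there is a WIDTH M ≥ k+2 in which the
counted points number ≤ C·T^κ for
all large T with κ BELOW THE AMPLIFICATION EXPONENT (M−k−1)k (levels k ≥ 2: CountingGapHigher; level
k = 1, the (1, πi) cell:
CountingGapPair). This is the arithmetic form, on the exponential leaf Γ_M = {(w, e^w)}, of the
relation-counting conjecture of
Binyamini–Hirata-Kohno–Kawashima–Salant (arXiv:2604.15189 Conj. 1, printed open: "the full
conjecture appears to be far more
challenging … progress would probably require completely new ideas", pp. 3–4, §2.3). No card is
realised (novel-route seat, operator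
open-question-harvest).
Lean: `(∀ k : ℕ, 2 ≤ k → ∀ b : ℝ, 0 < b → ∃ M : ℕ, k + 2 ≤ M ∧ ∃ κ : ℝ, κ < ((M : ℝ) - k - 1) * k ∧
∃ C : ℝ, ∀ᶠ T : ℝ in Filter.atTop, ({w : Fin M → ℂ | (∀ i, |(w i).re| ≤ T ∧ |(w i).im| ≤ b) ∧ (∃ f :
Fin (k + 1) ↪ Fin M, LinearIndependent ℚ (w ∘ f)) ∧ ∃ (s : ℕ) (P : Fin s → MvPolynomial (Fin M ⊕ Fin
M) ℤ) (e : Fin M ↪ Fin s), 2 * M ≤ s + k ∧ (∀ j, ((P j).totalDegree : ℝ) ≤ T ∧ ∀ mo, |(((P j).coeff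
mo : ℤ) : ℝ)| ≤ T) ∧ (∀ j, MvPolynomial.aeval (Sum.elim w (Complex.exp ∘ w)) (P j) = 0) ∧
LinearIndependent ℂ (fun j => fun i : Fin M ⊕ Fin M => MvPolynomial.aeval (Sum.elim w (Complex.exp ∘
w)) (MvPolynomial.pderiv i (P j))) ∧ (Matrix.of fun i j : Fin M => MvPolynomial.aeval (Sum.elim w
(Complex.exp ∘ w)) (MvPolynomial.pderiv (Sum.inl j) (P (e i)) + MvPolynomial.X (Sum.inr j) *
MvPolynomial.pderiv (Sum.inr j) (P (e i)))).det ≠ 0}).encard ≤ ((⌊C * T ^ κ⌋₊ : ℕ) : ℕ∞)) ∧ (∀ b :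
ℝ, 0 < b → ∃ M : ℕ, 3 ≤ M ∧ ∃ κ : ℝ, κ < (M : ℝ) - 2 ∧ ∃ C : ℝ, ∀ᶠ T : ℝ in Filter.atTop, ({w : Fin
M → ℂ | (∀ i, |(w i).re| ≤ T ∧ |(w i).im| ≤ b) ∧ (∃ f : Fin 2 ↪ Fin M, LinearIndependent ℚ (w ∘ f))
∧ ∃ (s : ℕ) (P : Fin s → MvPolynomial (Fin M ⊕ Fin M) ℤ) (e : Fin M ↪ Fin s), 2 * M ≤ s + 1 ∧ (∀ j,
((P j).totalDegree : ℝ) ≤ T ∧ ∀ mo, |(((P j).coeff mo : ℤ) : ℝ)| ≤ T) ∧ (∀ j, MvPolynomial.aeval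
(Sum.elim w (Complex.exp ∘ w)) (P j) = 0) ∧ LinearIndependent ℂ (fun j => fun i : Fin M ⊕ Fin M =>
MvPolynomial.aeval (Sum.elim w (Complex.exp ∘ w)) (MvPolynomial.pderiv i (P j))) ∧ (Matrix.of fun i
j : Fin M => MvPolynomial.aeval (Sum.elim w (Complex.exp ∘ w)) (MvPolynomial.pderiv (Sum.inl j) (P
(e i)) + MvPolynomial.X (Sum.inr j) * MvPolynomial.pderiv (Sum.inr j) (P (e i)))).det ≠ 0}).encard ≤
((⌊C * T ^ κ⌋₊ : ℕ) : ℕ∞))`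

## Assembly
Pure logic plus real asymptotics, kernel-checked (Sketch.lean / glue.lean `closes`, rc 0 on the
farm): if Schanuel failed,
Amplification gives a level k ≥ 1, a strip b and, for every width M ≥ k+2, eventually
⌈c·T^((M−k−1)k)⌉ ≤ encard(counted set);
CountingGapPair (k = 1) resp. CountingGapHigher (k ≥ 2) gives one width M with eventually encard ≤
⌊C·T^κ⌋, κ < (M−k−1)k; hence
c·T^a ≤ max(C·T^κ, 0) for some large T with C·T^(κ−a) < c — absurd. Amplification — provable now but
not yet proved — is the third hypothesis of `closes` and is
therefore filed as a CRUX (kind crux, rank 9) under the crux-only deciding-theorem rule (only crux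
items may be hypotheses of
`closes`) until a Theorems file proves it; FirstFailurePresentation stays a support feeding that
proof. `closes` is certified:
sorry-free, conclusion `_root_.Schanuel` by name, hypotheses = the three crux decls
(#h21_check_closes ok, non_crux = []).

Rationale: WHY THIS LINE. Counting theorems (BombieriPila1989, PilaWilkie2006, Wilkie's conjecture =
BinyaminiNovikovZak2024) bound the number of arithmetic
exceptions on a transcendental set WITHOUT locating any of them; Pila2010 p. 493 observed that such
a bound with a uniform exponent on
a GROUP yields transcendence ("42 exponentials"), and BinyaminiEtAl2026 (arXiv:2604.15189)
formulated counting of ALGEBRAIC RELATIONS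
(points of X on ℚ̄-varieties of dimension k < codim X, polynomial in degree + log-height) as "to
algebraic independence what Wilkie's
conjecture is to transcendence", proving the weak form on D-property curves (Thm 4) and deducing
only bounded rank / trdeg → ∞
results (Prop. 12). The new move here is WIDTH AMPLIFICATION: one first failure z of rank k+1
(padded with 2πi to sit in a strip)
generates, inside Γ_M for EVERY M, ≥ c·T^{(M−k−1)k} distinct counted points (w = (z, Kz), K ∈
ℤ^{(M−k−1)×(k+1)}, entries ≍ T),
so a counting bound with ANY exponent below (M−k−1)k in ONE width M already decides Schanuel — no
rank → ∞, no uniformity in number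
fields, and the lower-bound leg is unconditional (algebra + the tree's first-failure Khovanskii
non-degeneracy). Imported area: tame
geometry / o-minimal point counting (interpolation determinants, cell parametrisation); the
arithmetic transcendental part (ℚ-rank ≥
k+1 plus codim-many independent relations) replaces BHKK's geometric X^trans(k), which is EMPTY on
Γ_M. No route among the 22 counts
relations by complexity: SheetDescent counts sheets on a fixed variety in imaginary height and
records that its second leg is missing;
AlgIndepMethod / DiophantineCore / CapacityLadder run Philippon's criterion under a Technical
Hypothesis.

RANKED CRUXES. #2 CountingGapHigher (crux) — for every level k ≥ 2 and strip height b > 0 there are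
a width M ≥ k+2, an exponent κ < (M−k−1)k and C such that for all large T the counted points of ℂ^M
at complexity T (|Re wᵢ| ≤ T, |Im wᵢ| ≤ b, some k+1 coordinates ℚ-linearly independent, ≥ 2M−k
integer relations of degree ≤ T and coefficients ≤ T at (w, e^w) with ℂ-independent gradients, M of
them a non-degenerate Khovanskii system) have encard ≤ ⌊C·T^κ⌋ — the arithmetic form of
BinyaminiEtAl2026 Conj. 1 in the degree aspect on the exponential leaf; every counted point is a
Schanuel counterexample, so Schanuel ⇒ count 0. [difficulty: open-problem] (why it might fail:
SC-equivalent level by level (irrefutable short of ¬SC); known relation counting (arXiv:2604.15189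
Thm 4) is Philippon's criterion on curves and BNZ exponents grow with the format, while the
threshold (M−k−1)k is linear in M: the count must be governed by the deficit k, not the width.)
[arXiv:2604.15189, Pila2010, BinyaminiNovikovZak2024, PilaWilkie2006, BombieriPila1989, Lang1966]
#3 CountingGapPair (crux) — the same at level k = 1: for every b > 0 there are M ≥ 3, κ < M − 2 and
C with encard(counted points of ℂ^M at level 1, complexity T) ≤ ⌊C·T^κ⌋ for all large T. The first
failures whose ℚ-span contains 1 and πi land exactly here: the width amplification of (1, πi) is the
Gaussian-lattice ensemble {(a + επi, (−1)^ε e^a)}, counted iff e and π are algebraically DEPENDENT —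
so the crux implies e ⊥ π and is implied by SchanuelTwo (stmt-Schanuel-0069). [difficulty:
open-problem] (why it might fail: contains e ⊥ π (ExpOnePiAlgebraicIndependent, open); at a single
seed the count is all-or-nothing (≈ T^(M−2) points or none), so counting must act on the ENSEMBLE of
presentations of height ≤ T, where nothing is known beyond level 0 (Hermite–Lindemann).)
[arXiv:2604.15189, Pila2010, Waldschmidt2000, NesterenkoPhilippon2001, BinyaminiNovikovZak2024]
#9 Amplification (crux until proved — it is a hypothesis of `closes`; provable now, difficulty L) —
WIDTH AMPLIFICATION: if Schanuel fails, take a first failure z (tree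
exists_firstFailure_of_not_schanuel; rank n, trdeg n−1, non-degenerate Khovanskii point of its own
locus by firstFailure_khovanskii); pad it with 2πi when 2πi ∉ span_ℚ z (else use the period relation
q·2πi ∈ span_ℤ z); with k = rank − 1 and b the strip height of the padded tuple z*, for EVERY width
M ≥ k+2 the points w = (z*, K z*) with K ∈ ℤ^((M−k−1)×(k+1)), entries ≤ N ≍ T, rows shifted by the
period vector so that Im ∈ [0, 2π|q|), are ≥ c·T^((M−k−1)k) distinct counted points at complexity T
for all large T (relations: the k+2 base relations of FirstFailurePresentation, M−k−1 linear rows of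
height ≤ C N, M−k−1 cleared monomial rows of degree ≤ C N and coefficients ±1; gradients
block-triangular; Khovanskii minor = det(tree system)·1; eventually-form with ⌈c T^a⌉ ≤ encard).
SIMPLER CONSTRUCTION (route-repair note 2026-08-16, recommended to the prover): no 2πi-padding and
no period shift are needed — take z* = z itself (k = n − 1 ≥ 1 since n ≥ 2), and for each of the
M−k−1 rows restrict K_r ∈ ℤ^(k+1) to the slab |K_r · Im z| ≤ b by choosing the k entries K_(r,i), i
≠ i₀, freely in [−N, N] and solving for K_(r,i₀) (i₀ any index with Im z_(i₀) ≠ 0, |K_(r,i₀)| ≤ C·N;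
if z ∈ ℝⁿ every K_r qualifies), b := max_i |Im z_i| + 1; distinct K give distinct w because z is
ℚ-independent, so the counted set has ≥ (2N+1)^((M−k−1)k) ≥ c·T^((M−k−1)k) elements with N ≍ T/C;
relations: the k+2 = n+1 base relations of FirstFailurePresentation, the linear rows X_(k+1+r) − Σ
K_(r,i) X_i (degree 1, height ≤ C N) and the monomial rows Y_(k+1+r)·Π_(K<0) Y_i^(−K) − Π_(K>0)
Y_i^K (degree ≤ 1 + (k+1)·C·N, coefficients ±1); gradients are independent by the new coordinates
X_(k+1+r), Y_(k+1+r); take e = the n base Khovanskii rows followed by the linear rows: the M×M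
Khovanskii matrix is block lower-triangular with an identity corner, det = det(base system) ≠ 0, the
base system being the LANDED
`Summit.Schanuel.Schanuel.Theorems.MinimalCounterexampleInAcl.Negative.firstFailure_khovanskii`
(Theorems/MinimalCounterexampleInAcl/Negative/KhovanskiiPoint.lean, sorry-free) with ℚ-denominators
cleared. [difficulty: L] [arXiv:2604.15189, Pila2010, Lang1966, Kirby2010EAEF, Ax1971]
#9 FirstFailurePresentation (support; used inside the proof of Amplification, never a hypothesis of
`closes`) — a first failure x ∈ ℂⁿ (ℚ-linearly independent, trdeg ℚ(x, eˣ) < n, Schanuel in all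
ranks < n) admits n+1 integer polynomial relations vanishing at (x, eˣ) with ℂ-linearly independent
gradients, the first n forming a non-degenerate Khovanskii system: the tree's
firstFailure_khovanskii (denominators cleared) plus one cleared minimal-polynomial relation of a
coordinate over a transcendence basis chosen among the coordinates — its gradient leaves the span of
the first n because the relation gradients at x span a space of dimension 2n − trdeg ≥ n+1 (dim
Ω_(ℚ(x,eˣ)/ℚ) = trdeg). [difficulty: M] [Kirby2010EAEF, Ax1971, Lang1966]

TWO-LAYER PLAN. Foreseen glued splits (not filed now; k ≤ 3, depth 1). CountingGapHigher ⇐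
UnitCellCluster (the counted points of width M meet ≤
C·T^κ₁ unit cells of the strip-box — growth control in the Re-directions; BinyaminiEtAl2026 Conj. 3
made arithmetic at unit radius)
→ PerCellGap (one unit cell, a COMPACT piece of Γ_M definable in ℝ_an,exp, holds ≤ C·T^κ₂ counted
points — BHKK's Conjecture 1 in its
native compact setting, degree aspect) → CountingGapHigher with κ₁ + κ₂ < (M−k−1)k. The same split
for CountingGapPair. Amplification
⇐ FirstFailurePresentation → StripSlaving (period-shifted rows: distinctness, height ≤ C N, Im ∈ [0,
2π|q|)) → Amplification. An
ALTERNATIVE deciding line (separate route if this one stalls): UnitCellCluster with κ₁ < M−k−1 ALONE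
decides Schanuel once first
failures are padded with (1, 2πi) (rank-2 real structure ⇒ ≤ C·T^(k−1) amplified rows per unit cell,
no Diophantine hypothesis).

KILL CRITERIA. (i) If the presentation clauses do NOT force trdeg ℚ(w, e^w) ≤ k (the Ω_(ℚ(x)/ℚ)
argument fails in Lean's reading of the clauses),
generic swarms make both cruxes FALSE outright — close `refuted:CountingGapPair` (this is how card
random-khovanskii-pair-correlation
died). (ii) A refutation of Amplification as typed (box / height / strip constants mis-set) breaks
the route only formally (it is a `closes`
hypothesis): repair = a restated AmplificationR (refuted-misstated class) and re-certified glue, not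
closure of the line. (iii) A no-go theorem "o-minimal counting on Γ_M ∩ strip cannot beat exponent
(M−k−1)k on the amplified family" kills the
strong line — pivot to the Two-layer split / the UnitCellCluster route. (iv) Proved elsewhere:
SchanuelTwo (stmt-Schanuel-0069) makes
CountingGapPair vacuously true; Schanuel moots everything; a proof of BHKK Conj. 1 with
format-uniform exponents linear in dim X would
prove CountingGapHigher for k large relative to that slope only.

NOT DECOMPOSED YET. Uniformity of κ and C in the strip height b; the effective special-locus version
(replace "k+1 coordinates ℚ-independent" by "no
ℤ-relation of height ≤ T^c", which makes the counted family definable for each T and is the form a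
Pila–Wilkie-type proof would
actually bound); the real sub-case (z ∈ ℝⁿ: ℝ_exp, no strip needed); the clustering constants;
whether M can be taken = k+2. All are
layer-2 children once a prover fixes the counting technology.

CHEAPEST FALSIFIER. None numerical: every counted point is a counterexample to Schanuel, so neither
crux can be refuted short of ¬SC. The cheap
STRUCTURAL checks (done on paper, NOTES.md): (a) BHKK's own growth families (§2.1–2.2: rational z on
(z, e^z, …, e^(zⁿ)); multiplicative
pencils zⁿ = (1+z)^m) have ℚ-rank 1 and are excluded by the rank clause; (b) the swarm that
falsified random-khovanskii-pair-correlation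
(generic zeros of height-h systems) is excluded because ≥ 2M−k relations with independent gradients
force trdeg ≤ k; (c) refuter task
= formalise (b) as `∀ x : Fin (2M) → ℂ, (s relations with ℂ-independent gradients) → trdeg ℚ(x) ≤ 2M
− s` — if THAT fails, kill
criterion (i) fires. `lean check Sketch.lean`: rc 0, closes sorry-free.

NUMBERS. Amplification exponent: ≥ c·T^((M−k−1)k) counted points from one first failure of padded
rank k+1 (this route); needed: κ < (M−k−1)k.
BHKK Thm 4 (arXiv:2604.15189): weak conjecture on arithmetic-D-property trajectories Γ ⊂ ℂⁿ for k <
√n − 1, (g+h)^(ρC) balls of radius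
e^(−(g+h)^ρ); Thm 2: #X^trans(k)(k,g,h) ≤ poly_(X,g)(h) for fixed g; Conj. 1: poly_X(g,h); Prop. 12:
bounded multiplicative rank only.
Pila2010: #X^trans(F,T) ≤ c(f,ε)(log T)^(44+ε) on log x·log y = log z; #W_α(F,T) ≤ C(f)(log T)^20 ⇒
42 exponentials. Level 0 of the
count is empty by Hermite–Lindemann; level 1 contains e ⊥ π; (log 2, log 3) padded with (2πi) lands
at level 3 [B1].

DEFINITION REQUESTS. None: all items are stated over Mathlib
(MvPolynomial.aeval/pderiv/coeff/totalDegree, Matrix.det, LinearIndependent, Set.encard,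
Filter.atTop, Real.rpow, Nat.floor/ceil, Algebra.trdeg, IntermediateField.adjoin) and the summit
constant `_root_.Schanuel`.

Novelty: Searches (2026-08-16): `lit frontier Schanuel --since 2022` (60 rows; arXiv:2604.15189 read pp. 1–9
in full; arXiv:2504.14041/2504.14048, arXiv:2603.08365, arXiv:2309.02800 read for printed open
questions — elliptic / decidability / Chudnovsky-type, none summit-deciding); `lit galaxy search
"Schanuel's conjecture" --star all` (40 rows: model theory, Skolem, o-minimality notes), `"implies
Schanuel" --star all` (1), `"Exponential motives"`/`"Schanuel conjecture" --star pdf` (2/11); `lit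
search --source arxiv --year-from 2023` for "Schanuel conjecture" (7), "algebraic independence
exponential" (8), "exponential periods" (5), "Zilber exponential field" (3), "small value
estimates…" (0 relevant); `lit vsearch` ×2 (counting algebraic points; amplification) → Pila2022
(read Ch. 13, pp. 82–83), Baker1975, Chudnovsky1984; Pila2010 = doi:10.5802/aif.2530 read pp.
490–494; local `lit search` index unavailable all session (searchd ConnectionReset; openalex 429).
Card index: the 10 Schanuel cards citing 2604.15189 read (cluster-rank-drop-technical-hypothesis
[routed → ClusterRankDrop, retired], sparse-sheets-wilkie-counting [→ SheetDescent],
random-khovanskii-pair-correlation [falsified], exp-log-diagonal-trajectory,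
modulus-first-certification, period-lattice-rigidity-baker, q-gamma, ss-loses-at-most-one,
two-moduli-nesterenko, lul-residual) — none amplifies in width or counts rank-constrained relation
points; `ledger negatives --problem Schanuel` (2, PolarPhantoms).
Nearest prior art fo  [refs: 10.5802/aif.2530, 2604.15189, 2504.14041, 2603.08365, 2309.02800, doi:10.5802/aif.2530, Pila2022, Baker1975, Chudnovsky1984, Pila2010, BinyaminiEtAl2026]

Barriers (technique_class: o-minimal-relation-counting, width-amplification): - technique_class: o-minimal-relation-counting, width-amplification
- Literature.Barriers.Schanuel.AlgebraicIndependenceOfLogarithms: not evaded but relocated: (log 2,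
log 3) padded with 2πi lands at level 3, so AlgIndepLogarithms is promised only through
CountingGapHigher at k = 3 — from an exponent gap in a count, never from linear forms in logarithms
or LST rank bounds.
- Literature.Barriers.Schanuel.LinearSubgroupMethodLimit: no LST, no linear embeddings into
determinantal varieties; n/a.
- Literature.Barriers.Schanuel.LargeTranscendenceDegree: the strong count is to be attacked by
interpolation-determinant / cell-parametrisation counting (BombieriPila1989, PilaWilkie2006,
BinyaminiNovikovZak2024), which needs no lower bound for |P| at the point and no Technical
Hypothesis; the lower-bound leg (Amplification) is unconditional; the bet is that counting in the
degree aspect can have exponent governed by the deficit k. A fallback on Philippon's criterion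
(arXiv:2604.15189 Thm 4) re-enters this barrier — the Two-layer split quarantines it in
UnitCellCluster.
- Literature.Barriers.Schanuel.EFunctionValuesAtAlgebraicPoints: no E-functions; the line is
indifferent to whether coordinates are algebraic.
- Literature.Barriers.Schanuel.NesterenkoModularScope: no modular input; the (1, πi) cell is
attacked as an ensemble count (CountingGapPair), not by a sector theorem — answering the C10 lesson
that the n = 2 sector atlas is exhausted.
- Literature.Barriers.Schanuel.PeriodConjecture

History (route lifecycle, newest last):
- 2026-08-23T07:27:05Z · DORMANT — reconciler: no traction for 6 d (last activity statement-checked at 2026-08-17T07:25:24Z); parked, not closed — `ledger route dormant route-Schanuel-RelationCou (operator:999:3064998)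

sub-problem: Schanuel · status: dormant · opened planner-plan-novel-Schanuel-Schanuel-03fec9a6-a-v2-g5-0 2026-08-16T18:12:02Z · rev 7 · ledger route-Schanuel-RelationCounting
GENERATED by the gate from the ledger (D-0016/17). Provers cite these decls: `theorem foo : Summit.Schanuel.Schanuel.Theses.RelationCounting.<Decl> := …` in Summits/Schanuel/Schanuel/Theorems/<Name>.lean.
-/

namespace Summit.Schanuel.Schanuel.Theses.RelationCounting

open scoped BigOperators Topology Manifold Classical MeasureTheory ProbabilityTheory Matrix InnerProductSpace ComplexConjugate ContinuousMap
open Filter Set Function TopologicalSpace MeasureTheory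

attribute [summit_statement] _root_.Schanuel

open Literature.Periods

/-- item stmt-Schanuel-16237 · crux · rank 2 · open · by planner
why it might fail: SC-equivalent level by level (irrefutable short of ¬SC); known relation counting (arXiv:2604.15189 Thm 4) is Philippon's criterion on curves and BNZ exponents grow with the format, while the threshold (M−k−1)k is linear in M: the count must be governed by the deficit k, not the width.
sources: arXiv:2604.15189, Pila2010, BinyaminiNovikovZak2024, PilaWilkie2006, BombieriPila1989, Lang1966
[crux] for every level k ≥ 2 and strip height b > 0 there are a width M ≥ k+2, an exponent κ <
(M−k−1)k and C such that for all large T the counted points of ℂ^M at complexity T (|Re wᵢ| ≤ T, |Im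
wᵢ| ≤ b, some k+1 coordinates ℚ-linearly independent, ≥ 2M−k integer relations of degree ≤ T and
coefficients ≤ T at (w, e^w) with ℂ-independent gradients, M of them a non-degenerate Khovanskii
system) have encard ≤ ⌊C·T^κ⌋ — the arithmetic form of BinyaminiEtAl2026 Conj. 1 in the degree
aspect on the exponential leaf; every counted point is a Schanuel counterexample, so Schanuel ⇒
count 0. [difficulty: open-problem] -/
@[route_item "route-Schanuel-RelationCounting", crux]
def CountingGapHigher : Prop :=
  ∀ k : ℕ, 2 ≤ k → ∀ b : ℝ, 0 < b → ∃ M : ℕ, k + 2 ≤ M ∧ ∃ κ : ℝ, κ < ((M : ℝ) - k - 1) * k ∧ ∃ C : ℝ, ∀ᶠ T : ℝ in Filter.atTop, ({w : Fin M → ℂ | (∀ i, |(w i).re| ≤ T ∧ |(w i).im| ≤ b) ∧ (∃ f : Fin (k + 1) ↪ Fin M, LinearIndependent ℚ (w ∘ f)) ∧ ∃ (s : ℕ) (P : Fin s → MvPolynomial (Fin M ⊕ Fin M) ℤ) (e : Fin M ↪ Fin s), 2 * M ≤ s + k ∧ (∀ j, ((P j).totalDegree : ℝ) ≤ T ∧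 ∀ mo, |(((P j).coeff mo : ℤ) : ℝ)| ≤ T) ∧ (∀ j, MvPolynomial.aeval (Sum.elim w (Complex.exp ∘ w)) (P j) = 0) ∧ LinearIndependent ℂ (fun j => fun i : Fin M ⊕ Fin M => MvPolynomial.aeval (Sum.elim w (Complex.exp ∘ w)) (MvPolynomial.pderiv i (P j))) ∧ (Matrix.of fun i j : Fin M => MvPolynomial.aeval (Sum.elim w (Complex.exp ∘ w)) (MvPolynomial.pderiv (Sum.inl j) (P (e i)) + MvPolynomial.X (Sum.inr j) * MvPolynomial.pderiv (Sum.inr j) (P (e i)))).det ≠ 0}).encard ≤ ((⌊C * T ^ κ⌋₊ : ℕ) : ℕ∞)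

/-- item stmt-Schanuel-16238 · crux · rank 3 · open · by planner
why it might fail: contains e ⊥ π (ExpOnePiAlgebraicIndependent, open); at a single seed the count is all-or-nothing (≈ T^(M−2) points or none), so counting must act on the ENSEMBLE of presentations of height ≤ T, where nothing is known beyond level 0 (Hermite–Lindemann).
sources: arXiv:2604.15189, Pila2010, Waldschmidt2000, NesterenkoPhilippon2001, BinyaminiNovikovZak2024
[crux] the same at level k = 1: for every b > 0 there are M ≥ 3, κ < M − 2 and C with encard(counted
points of ℂ^M at level 1, complexity T) ≤ ⌊C·T^κ⌋ for all large T. The first failures whose ℚ-span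
contains 1 and πi land exactly here: the width amplification of (1, πi) is the Gaussian-lattice
ensemble {(a + επi, (−1)^ε e^a)}, counted iff e and π are algebraically DEPENDENT — so the crux
implies e ⊥ π and is implied by SchanuelTwo (stmt-Schanuel-0069). [difficulty: open-problem] -/
@[route_item "route-Schanuel-RelationCounting", crux]
def CountingGapPair : Prop :=
  ∀ b : ℝ, 0 < b → ∃ M : ℕ, 3 ≤ M ∧ ∃ κ : ℝ, κ < (M : ℝ) - 2 ∧ ∃ C : ℝ, ∀ᶠ T : ℝ in Filter.atTop, ({w : Fin M → ℂ | (∀ i, |(w i).re| ≤ T ∧ |(w i).im| ≤ b) ∧ (∃ f : Fin 2 ↪ Fin M, LinearIndependent ℚ (w ∘ f)) ∧ ∃ (s : ℕ) (P : Fin s → MvPolynomial (Fin M ⊕ Fin M) ℤ) (e : Fin M ↪ Fin s), 2 * M ≤ s + 1 ∧ (∀ j, ((P j).totalDegree : ℝ) ≤ T ∧ ∀ mo, |(((P j).coeff mo : ℤ) : ℝ)| ≤ T) ∧ (∀ j, MvPolynomial.aeval (Sum.elim w (Complex.exp ∘ w)) (P j) = 0) ∧ LinearIndependent ℂ (fun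 j => fun i : Fin M ⊕ Fin M => MvPolynomial.aeval (Sum.elim w (Complex.exp ∘ w)) (MvPolynomial.pderiv i (P j))) ∧ (Matrix.of fun i j : Fin M => MvPolynomial.aeval (Sum.elim w (Complex.exp ∘ w)) (MvPolynomial.pderiv (Sum.inl j) (P (e i)) + MvPolynomial.X (Sum.inr j) * MvPolynomial.pderiv (Sum.inr j) (P (e i)))).det ≠ 0}).encard ≤ ((⌊C * T ^ κ⌋₊ : ℕ) : ℕ∞)

/-- item stmt-Schanuel-16239 · crux · rank 9 · open · by planner
why it might fail: The route's own unproved theorem (closes hypothesis): false as typed if the (k+2)-nd base relation with gradient outside the Khovanskii span is unavailable (needs dim of relation gradients = 2(k+1) − trdeg, via Kähler differentials) or the period-slaving budget |K'| ≤ C·N ≤ T fails uniformly in M.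
sources: arXiv:2604.15189, Pila2010, Lang1966, Kirby2010EAEF, Ax1971
[support] WIDTH AMPLIFICATION (provable now): if Schanuel fails, take a first failure z (tree
exists_firstFailure_of_not_schanuel; rank n, trdeg n−1, non-degenerate Khovanskii point of its own
locus by firstFailure_khovanskii); pad it with 2πi when 2πi ∉ span_ℚ z (else use the period relation
q·2πi ∈ span_ℤ z); with k = rank − 1 and b the strip height of the padded tuple z*, for EVERY width
M ≥ k+2 the points w = (z*, K z*) with K ∈ ℤ^((M−k−1)×(k+1)), entries ≤ N ≍ T, rows shifted by the
period vector so that Im ∈ [0, 2π|q|), are ≥ c·T^((M−k−1)k) distinct counted points at complexity T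
for all large T (relations: the k+2 base relations of FirstFailurePresentation, M−k−1 linear rows of
height ≤ C N, M−k−1 cleared monomial rows of degree ≤ C N and coefficients ±1; gradients
block-triangular; Khovanskii minor = det(tree system)·1; eventually-form with ⌈c T^a⌉ ≤ encard).
[difficulty: L] -/
@[route_item "route-Schanuel-RelationCounting", crux]
def Amplification : Prop :=
  ¬ _root_.Schanuel → ∃ k : ℕ, 1 ≤ k ∧ ∃ b : ℝ, 0 < b ∧ ∀ M : ℕ, k + 2 ≤ M → ∃ c : ℝ, 0 < c ∧ ∀ᶠ T : ℝ in Filter.atTop, ((⌈c * T ^ (((M : ℝ) - k - 1) * k)⌉₊ : ℕ) : ℕ∞) ≤ ({w : Fin M → ℂ | (∀ i, |(w i).re| ≤ T ∧ |(w i).im| ≤ b) ∧ (∃ f : Fin (k + 1) ↪ Fin M, LinearIndependent ℚ (w ∘ f)) ∧ ∃ (s : ℕ) (P : Fin s → MvPolynomial (Fin M ⊕ Fin M) ℤ) (e : Fin M ↪ Fin s), 2 * M ≤ s + k ∧ (∀ j, ((P j).totalDegree : ℝ) ≤ T ∧ ∀ mo, |(((P j).coeff mo : ℤ) : ℝ)|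 ≤ T) ∧ (∀ j, MvPolynomial.aeval (Sum.elim w (Complex.exp ∘ w)) (P j) = 0) ∧ LinearIndependent ℂ (fun j => fun i : Fin M ⊕ Fin M => MvPolynomial.aeval (Sum.elim w (Complex.exp ∘ w)) (MvPolynomial.pderiv i (P j))) ∧ (Matrix.of fun i j : Fin M => MvPolynomial.aeval (Sum.elim w (Complex.exp ∘ w)) (MvPolynomial.pderiv (Sum.inl j) (P (e i)) + MvPolynomial.X (Sum.inr j) * MvPolynomial.pderiv (Sum.inr j) (P (e i)))).det ≠ 0}).encard

/-- item stmt-Schanuel-16240 · support · rank 9 · open · by planner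
sources: Kirby2010EAEF, Ax1971, Lang1966
[support] a first failure x ∈ ℂⁿ (ℚ-linearly independent, trdeg ℚ(x, eˣ) < n, Schanuel in all ranks
< n) admits n+1 integer polynomial relations vanishing at (x, eˣ) with ℂ-linearly independent
gradients, the first n forming a non-degenerate Khovanskii system: the tree's
firstFailure_khovanskii (denominators cleared) plus one cleared minimal-polynomial relation of a
coordinate over a transcendence basis chosen among the coordinates — its gradient leaves the span of
the first n because the relation gradients at x span a space of dimension 2n − trdeg ≥ n+1 (dim
Ω_(ℚ(x,eˣ)/ℚ) = trdeg). [difficulty: M] -/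
@[route_item "route-Schanuel-RelationCounting"]
def FirstFailurePresentation : Prop :=
  ∀ (n : ℕ) (x : Fin n → ℂ), LinearIndependent ℚ x → Algebra.trdeg ℚ ↥(IntermediateField.adjoin ℚ (Set.range x ∪ Set.range (Complex.exp ∘ x))) < (n : Cardinal) → (∀ r < n, ∀ y : Fin r → ℂ, LinearIndependent ℚ y → (r : Cardinal) ≤ Algebra.trdeg ℚ ↥(IntermediateField.adjoin ℚ (Set.range y ∪ Set.range (Complex.exp ∘ y)))) → ∃ P : Fin (n + 1) → MvPolynomial (Fin n ⊕ Fin n) ℤ, (∀ j, MvPolynomial.aeval (Sum.elim x (Complex.exp ∘ x)) (P j) = 0) ∧ LinearIndependent ℂ (fun j => fun i : Fin n ⊕ Fin n => MvPolynomial.aeval (Sum.elim x (Complex.exp ∘ x)) (MvPolynomial.pderiv i (P j))) ∧ (Matrix.of fun i j : Fin n => MvPolynomial.aeval (Sum.elim x (Complex.exp ∘ x)) (MvPolynomial.pderiv (Sum.inl j) (P (Fin.castSucc i)) + MvPolynomial.X (Sum.inr j) * MvPolynomial.pderiv (Sum.inr j) (P (Fin.castSucc i)))).det ≠ 0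

/-- item stmt-Schanuel-16241 · assembly · rank 1 · open · by planner
sources: arXiv:2604.15189, Pila2010
[assembly] CountingGapHigher → CountingGapPair → Amplification → Schanuel. -/
@[route_item "route-Schanuel-RelationCounting"]
def Assembly : Prop :=
  CountingGapHigher → CountingGapPair → Amplification → _root_.Schanuel

/-! D-0027 §2.1 — DECIDING THEOREM (planner-authored via `route open/edit --closes-file`; by planner-rbadge-Schanuel-RelationCounting-92dbe9b1-0 2026-08-16T18:23:06Z):
its hypotheses are this route's items and its conclusion the sub-problem Statement (glue_lint), and it elaborates with this file. -/

@[closes "route-Schanuel-RelationCounting"] theorem closes (hHigher : CountingGapHigher) (hPair : CountingGapPair) (hAmp : Amplification) :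
    _root_.Schanuel := by
  by_contra hS
  obtain ⟨k, hk1, b, hb, hprod⟩ := hAmp hS
  -- abstract asymptotic contradiction: a count that is eventually ≥ ⌈c·T^a⌉ cannot be eventually ≤ ⌊C·T^κ⌋ when κ < a
  have contra : ∀ (M : ℕ) (S : ℝ → Set (Fin M → ℂ)) (κ a : ℝ), κ < a → ∀ (C c : ℝ), 0 < c →
      (∀ᶠ T : ℝ in Filter.atTop, (S T).encard ≤ ((⌊C * T ^ κ⌋₊ : ℕ) : ℕ∞)) →
      (∀ᶠ T : ℝ in Filter.atTop, ((⌈c * T ^ a⌉₊ : ℕ) : ℕ∞) ≤ (S T).encard) → False := by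
    intro M S κ a hκ C c hc hC hcT
    have hlim : Filter.Tendsto (fun T : ℝ => C * T ^ (κ - a)) Filter.atTop (nhds (C * 0)) :=
      (tendsto_rpow_neg_atTop (by linarith : 0 < a - κ)).const_mul C |>.congr' (by
        filter_upwards [Filter.eventually_gt_atTop (0 : ℝ)] with T hT
        rw [neg_sub])
    have hsmall : ∀ᶠ T : ℝ in Filter.atTop, C * T ^ (κ - a) < c :=
      hlim.eventually_lt_const (by simpa using hc)
    obtain ⟨T, hTpos, hle1, hle2, hlt⟩ :=
      ((Filter.eventually_gt_atTop (0 : ℝ)).and (hcT.and (hC.and hsmall))).exists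
    have h1 : (⌈c * T ^ a⌉₊ : ℕ) ≤ ⌊C * T ^ κ⌋₊ := by
      have := hle1.trans hle2
      exact_mod_cast this
    have h2 : c * T ^ a ≤ (⌈c * T ^ a⌉₊ : ℕ) := Nat.le_ceil _
    have h3 : ((⌊C * T ^ κ⌋₊ : ℕ) : ℝ) ≤ max (C * T ^ κ) 0 := by
      rcases le_or_gt 0 (C * T ^ κ) with h | h
      · exact (Nat.floor_le h).trans (le_max_left _ _)
      · rw [Nat.floor_of_nonpos h.le]
        simp
    have h4 : c * T ^ a ≤ max (C * T ^ κ) 0 := by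
      calc c * T ^ a ≤ (⌈c * T ^ a⌉₊ : ℕ) := h2
        _ ≤ ((⌊C * T ^ κ⌋₊ : ℕ) : ℝ) := by exact_mod_cast h1
        _ ≤ max (C * T ^ κ) 0 := h3
    have hTa : 0 < T ^ a := Real.rpow_pos_of_pos hTpos a
    have hsplit : C * T ^ κ = C * T ^ (κ - a) * T ^ a := by
      rw [mul_assoc, ← Real.rpow_add hTpos]
      ring_nf
    have h5 : C * T ^ κ < c * T ^ a := by
      rw [hsplit]
      exact mul_lt_mul_of_pos_right hlt hTa
    have h6 : max (C * T ^ κ) 0 < c * T ^ a := max_lt h5 (mul_pos hc hTa)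
    exact absurd h4 (not_le.mpr h6)
  rcases Nat.lt_or_ge k 2 with hk2 | hk2
  · have hk : k = 1 := by omega
    subst hk
    obtain ⟨M, hM, κ, hκ, C, hC⟩ := hPair b hb
    obtain ⟨c, hc, hcT⟩ := hprod M (by omega)
    exact contra M _ κ _ (by push_cast; linarith) C c hc hC hcT
  · obtain ⟨M, hM, κ, hκ, C, hC⟩ := hHigher k hk2 b hb
    obtain ⟨c, hc, hcT⟩ := hprod M hM
    exact contra M _ κ _ hκ C c hc hC hcT

end Summit.Schanuel.Schanuel.Theses.RelationCounting
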